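import Literature.AlgebraicGeometry.Resolution.AffineBlowup
import Literature.AlgebraicGeometry.Resolution.CanonicalResolutionProofs
import Literature.AlgebraicGeometry.Resolution.QuasiExcellentSchemes
import HarnessLib

/-!
# `SectionAscent.FibrewiseClosedPoints`, line `registered`: closed points suffice

Route `ResolutionOfSingularities/SectionAscent`, crux `FibrewiseClosedPoints`
(stmt-ResolutionOfSingularities-15960), stub `stub_closedPointsSuffice` of the lead's skeleton
`Cruxes/FibrewiseClosedPoints/Lines/birth.lean`, PROVED here (statement verbatim from the ledger
registration).

**Statement.** For an algebra `A` of finite type over a field `K` and any ideal `I ⊆ A`, if the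
local ring of the blowing up `Bl_I(Spec A) = Proj A[It]` (`affineBlowup I`) at every CLOSED point
is regular, then `Bl_I(Spec A)` is regular.

**Proof.** `A` is Noetherian, so `Bl_I(Spec A) → Spec A` is proper (`affineBlowup.isProper`), in
particular locally of finite type and quasi-compact; composing with `Spec A → Spec K` (locally of
finite type since `A` is of finite type over `K`) exhibits `Bl_I(Spec A)` as a scheme locally of
finite type over a field, whose regular locus is therefore open
(`isOpen_regularLocus_of_locallyOfFiniteType_field`, Matsumura, Cor. to Thm. 30.5). The underlying
space is quasi-compact (quasi-compact over the quasi-compact `Spec A`) and T₀, so the closed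
complement of the regular locus, if nonempty, contains a closed point
(`IsClosed.exists_closed_singleton`) — contradicting the hypothesis.
-/

noncomputable section

set_option linter.dupNamespace false -- mandated namespace of this single-conjunct summit

open CategoryTheory AlgebraicGeometry
open Literature.AlgebraicGeometry.Resolution

namespace Summit.ResolutionOfSingularities.ResolutionOfSingularities.Theorems.SectionAscent.ClosedPointsSuffice

universe u

/-- **Closed points suffice for regularity of a quasi-compact scheme locally of finite type over a
field**: the regular locus is open (Matsumura, Cor. to Thm. 30.5, in-tree
`isOpen_regularLocus_of_locallyOfFiniteType_field`), and a nonempty closed subset of a compact T₀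
space contains a closed point (`IsClosed.exists_closed_singleton`). -/
theorem isRegular_of_isClosed_singleton {k : Type u} [Field k] {X : Scheme.{u}}
    (f : X ⟶ Spec (.of k)) [LocallyOfFiniteType f] [CompactSpace X]
    (h : ∀ x : X, IsClosed ({x} : Set X) → IsRegularLocalRing (X.presheaf.stalk x)) :
    Literature.AlgebraicGeometry.Resolution.Scheme.IsRegular X := by
  intro x
  by_contra hx
  have hcl : IsClosed (Literature.AlgebraicGeometry.Resolution.Scheme.regularLocus X)ᶜ :=
    (isOpen_regularLocus_of_locallyOfFiniteType_field f).isClosed_compl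
  obtain ⟨y, hy, hyc⟩ := hcl.exists_closed_singleton ⟨x, hx⟩
  exact hy (h y hyc)

/-- **Closed points suffice for regularity of a blowing up.** For an algebra `A` of finite type
over a field `K` and any ideal `I`, if the local ring of `Bl_I(Spec A)` at every CLOSED point is
regular then `Bl_I(Spec A)` is regular: `Bl_I(Spec A) → Spec A → Spec K` is locally of finite type
(the blowing up of a Noetherian affine scheme is proper), so the regular locus is open
(`isOpen_regularLocus_of_locallyOfFiniteType_field`, Matsumura Cor. to Thm. 30.5); its complement
is a closed subset of a quasi-compact T₀ space, hence empty or containing a closed point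
(`IsClosed.exists_closed_singleton`). -/
theorem stub_closedPointsSuffice (K : Type) [Field K] (A : Type) [CommRing A] [Algebra K A]
    [Algebra.FiniteType K A] (I : Ideal A)
    (h : ∀ y : Literature.AlgebraicGeometry.Resolution.affineBlowup I,
      IsClosed ({y} : Set (Literature.AlgebraicGeometry.Resolution.affineBlowup I)) →
        IsRegularLocalRing ((Literature.AlgebraicGeometry.Resolution.affineBlowup I).presheaf.stalk y)) :
    Literature.AlgebraicGeometry.Resolution.Scheme.IsRegular
      (Literature.AlgebraicGeometry.Resolution.affineBlowup I) := by
  haveI : IsNoetherianRing A := Algebra.FiniteType.isNoetherianRing K A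
  haveI : LocallyOfFiniteType (Spec.map (CommRingCat.ofHom (algebraMap K A))) := by
    rw [HasRingHomProperty.Spec_iff (P := @LocallyOfFiniteType)]
    exact RingHom.finiteType_algebraMap.mpr ‹_›
  haveI : CompactSpace (affineBlowup I) :=
    QuasiCompact.compactSpace_of_compactSpace (affineBlowup.π I)
  exact isRegular_of_isClosed_singleton
    (affineBlowup.π I ≫ Spec.map (CommRingCat.ofHom (algebraMap K A))) h

end Summit.ResolutionOfSingularities.ResolutionOfSingularities.Theorems.SectionAscent.ClosedPointsSuffice

end
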